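import Mathlib
import Summits.KontsevichZagierPeriods.KontsevichZagierPeriods.Theorems.InverseLandauTateLiftingTranscSector
import Summits.KontsevichZagierPeriods.KontsevichZagierPeriods.Theorems.InverseLandauTateLiftingProdSplit
import Summits.KontsevichZagierPeriods.KontsevichZagierPeriods.Theorems.InverseLandauTateLiftingQuarterPi
import Summits.KontsevichZagierPeriods.KontsevichZagierPeriods.Theorems.InverseLandauTateLiftingSqrtSubst
import Summits.KontsevichZagierPeriods.KontsevichZagierPeriods.Theorems.InverseLandauTateLiftingBetaThirdPi
import Summits.KontsevichZagierPeriods.KontsevichZagierPeriods.Theorems.InverseLandauTateLiftingBetaQuarterPi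
import Summits.KontsevichZagierPeriods.KontsevichZagierPeriods.Theorems.TerasomaMultiplicationGammaHodgeSectorDefs

/-!
# `TateLifting` (stmt-KontsevichZagierPeriods-9129), line `Sketch` — the transcendence sector: entries,
# pair forms and Beta-value instances

Companion to `Theorems/InverseLandauTateLiftingTranscSector.lean` (lead c6). That file proves the TRANSFER
(`transcRingKernel_sat`: `evalP` is injective on `K₀[x, T]` for every family `x` of formal periods with
algebraically independent values and every set `T` of torsion generators over `K₀[x]`, `K₀` = the ring of
dimension-zero classes) and its Lindemann / Chudnovsky instances. Here:

* §3 — how representations ENTER the sector rings through the moves landed in wave c6-1: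
  `[(0,1), 4 dx/(1+x²)]` has the class of the disc (`tateLifting_quarterPi`, stub 32), Fubini products
  have the product class (`tateLifting_prodSplit`, stub 31), the square substitution preserves the class
  (`tateLifting_sqrtSubst`, stub 33), point classes are generators;
* §4 — the two-representation forms ("equal values ⇒ KZ-equivalent") and a worked example;
* §5 — further transcendence inputs: the EQUIANHARMONIC Beta value `B(1/3,1/3) = √3·Γ(1/3)³/(2π)`
  (`tateLifting_betaThirdPiAlgIndependent`, stub 34, from Chudnovsky's pair `(π, Γ(1/3))` proved in
  the tree): `evalP` is injective on `ℚ̄[B(1/3,1/3), π, ζ(2), ζ(4), ζ(3,1), ζ(2,2), ζ(2,1,1)]`; and the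
  LEMNISCATIC Beta value `B(1/4,1/4) = Γ(1/4)²/√π` (`tateLifting_betaQuarterPiAlgIndependent`, stub 36,
  from Chudnovsky's pair `(π, Γ(1/4))`): `evalP` is injective on `ℚ̄[B(1/4,1/4), π, ζ(2), …, ζ(2,1,1)]`.

References: M. Kontsevich, D. Zagier, *Periods* (2001), §1.1 eq. (1), §1.2, §4.1; G. V. Chudnovsky,
*Contributions to the theory of transcendental numbers* (1984), Ch. 7 §2.
-/

noncomputable section

open MeasureTheory Set
open Literature.NumberTheory.Transcendental
open Literature.Analysis.SpecialFunctions (lemniscaticK lemniscaticE)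
open Summit.KontsevichZagierPeriods.Grothendieck.GpcLegendreLemniscaticNegative (kRep eRep kRep_value
  eRep_value)
open Summit.KontsevichZagierPeriods.MzvKernelInKZ.Negative (genSetAdm)
open Summit.KontsevichZagierPeriods.GammaHodgeSectorKO (betaClass evalP_betaClass IsBetaRep)

namespace Summit.KontsevichZagierPeriods.InverseLandau

/-! ## §3 How representations enter the sector rings (stubs 31–33 and eq. (1)) -/

/-- **`[(0,1), 4 dx/(1+x²)]` has the class of the disc** (`tateLifting_quarterPi`, stub 32).
[cite: KontsevichZagier2001, §1.1 eq. (1)] -/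
theorem toFormalPeriod_quarter_eq_piRep (r : KZ.IntegralRep 1)
    (hrd : r.domain = Set.pi Set.univ (fun _ => Set.Ioo (0 : ℝ) 1))
    (hri : Set.EqOn r.integrand (fun x => 4 / (1 + x 0 ^ 2)) r.domain) :
    KZ.toFormalPeriod (KZ.of r) = KZ.toFormalPeriod (KZ.of KZ.piRep) :=
  KZ.Equivalent.toFormalPeriod_eq (tateLifting_quarterPi r hrd hri)

/-- **Fubini products have the product class** (`tateLifting_prodSplit`, stub 31): a representation on
the product domain `σ × τ` with integrand `f ⊗ g` there has class `⟦[σ,f]⟧ · ⟦[τ,g]⟧`; in particular it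
lies in every subring containing the two factor classes. [cite: KontsevichZagier2001, §4.1] -/
theorem toFormalPeriod_of_prodSplit {n m : ℕ} (r : KZ.IntegralRep (n + m)) (s : KZ.IntegralRep n)
    (t : KZ.IntegralRep m)
    (hd : r.domain = {z | (fun i => z (Fin.castAdd m i)) ∈ s.domain ∧
      (fun j => z (Fin.natAdd n j)) ∈ t.domain})
    (hi : Set.EqOn r.integrand
      (fun z => s.integrand (fun i => z (Fin.castAdd m i)) * t.integrand (fun j => z (Fin.natAdd n j)))
      r.domain) :
    KZ.toFormalPeriod (KZ.of r) = KZ.toFormalPeriod (KZ.of s) * KZ.toFormalPeriod (KZ.of t) := by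
  rw [← map_mul, KZ.toFormalPeriod_eq_iff]
  exact tateLifting_prodSplit n m r s t hd hi

/-- Membership form of product splitting: if the factor classes lie in a subring, so does the class of
the product-shaped representation. [cite: KontsevichZagier2001, §4.1] -/
theorem toFormalPeriod_of_mem_of_prodSplit {n m : ℕ} (R : Subring KZ.FormalPeriodRing)
    (r : KZ.IntegralRep (n + m)) (s : KZ.IntegralRep n) (t : KZ.IntegralRep m)
    (hd : r.domain = {z | (fun i => z (Fin.castAdd m i)) ∈ s.domain ∧
      (fun j => z (Fin.natAdd n j)) ∈ t.domain})
    (hi : Set.EqOn r.integrand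
      (fun z => s.integrand (fun i => z (Fin.castAdd m i)) * t.integrand (fun j => z (Fin.natAdd n j)))
      r.domain)
    (hs : KZ.toFormalPeriod (KZ.of s) ∈ R) (ht : KZ.toFormalPeriod (KZ.of t) ∈ R) :
    KZ.toFormalPeriod (KZ.of r) ∈ R := by
  rw [toFormalPeriod_of_prodSplit r s t hd hi]
  exact R.mul_mem hs ht

/-- **The square substitution preserves the class** (`tateLifting_sqrtSubst`, stub 33): a representation
of dimension one over a domain in `(0, ∞)` has the class of its pull-back `[{t > 0, t² ∈ σ}, 2t·f(t²)]`.
[cite: KontsevichZagier2001, §1.2 rule (2)] -/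
theorem exists_sqrtSubst_toFormalPeriod_eq (r : KZ.IntegralRep 1) (hr : ∀ x ∈ r.domain, 0 < x 0) :
    ∃ r' : KZ.IntegralRep 1, r'.domain = {t | 0 < t 0 ∧ (fun _ : Fin 1 => t 0 ^ 2) ∈ r.domain} ∧
      Set.EqOn r'.integrand (fun t => 2 * t 0 * r.integrand (fun _ => t 0 ^ 2)) r'.domain ∧
      KZ.toFormalPeriod (KZ.of r') = KZ.toFormalPeriod (KZ.of r) := by
  obtain ⟨r', hd, hi, hrel⟩ := tateLifting_sqrtSubst r hr
  exact ⟨r', hd, hi, (KZ.toFormalPeriod_eq_iff.2 hrel).symm⟩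

/-- **Point classes are in every sector ring**: the class of a representation over `ℝ⁰` is a generator
of `K₀`. [folklore] -/
theorem toFormalPeriod_of_dimZero_mem {S : Set KZ.FormalPeriodRing} (b : KZ.IntegralRep 0)
    (hS : Set.range (fun b : KZ.IntegralRep 0 => KZ.toFormalPeriod (KZ.of b)) ⊆ S) :
    KZ.toFormalPeriod (KZ.of b) ∈ Subring.closure S :=
  Subring.subset_closure (hS ⟨b, rfl⟩)

/-! ## §4 Two-representation form -/

/-- **Equal values ⇒ KZ-equivalent, on the `ℚ̄[K(1/√2), π]`-root ring through weight 4 —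
unconditionally**: two integral representations (of any dimensions) whose classes lie in the subring
generated by the point classes, `⟦kRep⟧`, `⟦piRep⟧` and the admissible word classes of weights `2`, `4`,
and which have the same value, are equivalent under the moves of Kontsevich–Zagier.
[cite: KontsevichZagier2001, §1.2] -/
theorem equivalent_of_mem_kPiSector {n m : ℕ} (r : KZ.IntegralRep n) (r' : KZ.IntegralRep m)
    (hr : KZ.toFormalPeriod (KZ.of r) ∈ Subring.closure
        (Set.range (fun b : KZ.IntegralRep 0 => KZ.toFormalPeriod (KZ.of b)) ∪
          Set.range (![KZ.toFormalPeriod (KZ.of kRep), KZ.toFormalPeriod (KZ.of KZ.piRep)] :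
            Fin 2 → KZ.FormalPeriodRing) ∪
          KZ.toFormalPeriod '' (genSetAdm 2 ∪ genSetAdm 4)))
    (hr' : KZ.toFormalPeriod (KZ.of r') ∈ Subring.closure
        (Set.range (fun b : KZ.IntegralRep 0 => KZ.toFormalPeriod (KZ.of b)) ∪
          Set.range (![KZ.toFormalPeriod (KZ.of kRep), KZ.toFormalPeriod (KZ.of KZ.piRep)] :
            Fin 2 → KZ.FormalPeriodRing) ∪
          KZ.toFormalPeriod '' (genSetAdm 2 ∪ genSetAdm 4)))
    (hv : r.value = r'.value) : KZ.Equivalent r r' :=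
  transc_sub_mem_relations _ Transc.algebraicIndependent_vecKPi _ (Transc.wordClass_torsion _ 1 rfl)
    (KZ.of r) (KZ.of r') hr hr' (by rw [KZ.eval_of, KZ.eval_of, hv])

/-- **Example — `π` as a quarter circle against a scaled disc.** For a real-algebraic point `[pt, a]`
(any representation `b` over `ℝ⁰` with full domain) and any representation `r = [(0,1), 4/(1+x²)]`, a
representation `q` on the product domain `pt × (0,1)` with integrand `a ⊗ 4/(1+x²)` and ANY
representation `s` whose class lies in the `ℚ̄`-π-root ring are KZ-equivalent as soon as their values
agree — e.g. `s = [pt, a] · [disc, 1]`. (Membership of `q`: product splitting + quarter-circle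
normalisation; then `piSectorRingKernel`.) [cite: KontsevichZagier2001, §1.2] -/
theorem equivalent_pointMul_quarter {m : ℕ} (b : KZ.IntegralRep 0) (r : KZ.IntegralRep 1)
    (hrd : r.domain = Set.pi Set.univ (fun _ => Set.Ioo (0 : ℝ) 1))
    (hri : Set.EqOn r.integrand (fun x => 4 / (1 + x 0 ^ 2)) r.domain)
    (q : KZ.IntegralRep (0 + 1))
    (hqd : q.domain = {z | (fun i => z (Fin.castAdd 1 i)) ∈ b.domain ∧
      (fun j => z (Fin.natAdd 0 j)) ∈ r.domain})
    (hqi : Set.EqOn q.integrand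
      (fun z => b.integrand (fun i => z (Fin.castAdd 1 i)) * r.integrand (fun j => z (Fin.natAdd 0 j)))
      q.domain)
    (s : KZ.IntegralRep m)
    (hs : KZ.toFormalPeriod (KZ.of s) ∈ Subring.closure
        (Set.range (fun b : KZ.IntegralRep 0 => KZ.toFormalPeriod (KZ.of b)) ∪
          Set.range (![KZ.toFormalPeriod (KZ.of KZ.piRep)] : Fin 1 → KZ.FormalPeriodRing) ∪
          KZ.toFormalPeriod '' (genSetAdm 2 ∪ genSetAdm 4)))
    (hv : q.value = s.value) : KZ.Equivalent q s := by
  have hq : KZ.toFormalPeriod (KZ.of q) ∈ Subring.closure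
      (Set.range (fun b : KZ.IntegralRep 0 => KZ.toFormalPeriod (KZ.of b)) ∪
        Set.range (![KZ.toFormalPeriod (KZ.of KZ.piRep)] : Fin 1 → KZ.FormalPeriodRing) ∪
        KZ.toFormalPeriod '' (genSetAdm 2 ∪ genSetAdm 4)) := by
    refine toFormalPeriod_of_mem_of_prodSplit _ q b r hqd hqi ?_ ?_
    · exact Subring.subset_closure (Or.inl (Or.inl ⟨b, rfl⟩))
    · rw [toFormalPeriod_quarter_eq_piRep r hrd hri]
      exact Subring.subset_closure (Or.inl (Or.inr ⟨0, rfl⟩))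
  exact transc_sub_mem_relations _ Transc.algebraicIndependent_vecPi _ (Transc.wordClass_torsion _ 0 rfl)
    (KZ.of q) (KZ.of s) hq hs (by rw [KZ.eval_of, KZ.eval_of, hv])

/-! ## §5 Beta-value instances -/

namespace Transc

/-- The values of the family `![β(1/3,1/3), ⟦piRep⟧]`. [folklore] -/
theorem evalP_vecB3Pi :
    (fun i : Fin 2 => KZ.evalP ((![betaClass (1 / 3) (1 / 3), KZ.toFormalPeriod (KZ.of KZ.piRep)] :
      Fin 2 → KZ.FormalPeriodRing) i)) =
      ![ProbabilityTheory.beta ((1 / 3 : ℚ) : ℝ) ((1 / 3 : ℚ) : ℝ), Real.pi] := by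
  funext i
  fin_cases i
  · simp only [Fin.zero_eta, Fin.isValue, Matrix.cons_val_zero]
    exact evalP_betaClass (1 / 3) (1 / 3) (by norm_num) (by norm_num)
  · simp [KZ.piRep_value]

/-- **Chudnovsky (equianharmonic) in `P`**: the values of `β(1/3,1/3)`, `⟦piRep⟧` are algebraically
independent (`tateLifting_betaThirdPiAlgIndependent`, stub 34). [cite: Chudnovsky1984, Ch. 7 §2 Corollary 2.3] -/
theorem algebraicIndependent_vecB3Pi :
    AlgebraicIndependent ℚ fun i : Fin 2 =>
      KZ.evalP ((![betaClass (1 / 3) (1 / 3), KZ.toFormalPeriod (KZ.of KZ.piRep)] :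
        Fin 2 → KZ.FormalPeriodRing) i) := by
  rw [evalP_vecB3Pi]
  exact tateLifting_betaThirdPiAlgIndependent

end Transc

/-- **THE `ℚ̄[B(1/3,1/3), π]`-ROOT RING THROUGH WEIGHT 4 — UNCONDITIONAL.** `evalP` is injective on the
subring of the formal period ring generated by all dimension-zero classes, the Beta class
`β(1/3,1/3) = ⟦[(0,1), t^{-2/3}(1−t)^{-2/3}]⟧`, the disc `⟦piRep⟧` and the admissible word classes of
weights `2`, `4`: every polynomial identity with real-algebraic coefficients among
`B(1/3,1/3), π, ζ(2), ζ(4), ζ(3,1), ζ(2,2), ζ(2,1,1)` is derivable by the moves.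
[cite: Chudnovsky1984, Ch. 7 §2 Corollary 2.3] -/
theorem betaThirdPiSectorRingKernel :
    ∀ y ∈ Subring.closure
        (Set.range (fun b : KZ.IntegralRep 0 => KZ.toFormalPeriod (KZ.of b)) ∪
          Set.range (![betaClass (1 / 3) (1 / 3), KZ.toFormalPeriod (KZ.of KZ.piRep)] :
            Fin 2 → KZ.FormalPeriodRing) ∪
          KZ.toFormalPeriod '' (genSetAdm 2 ∪ genSetAdm 4)),
      KZ.evalP y = 0 → y = 0 :=
  transcRingKernel_sat _ Transc.algebraicIndependent_vecB3Pi _ (Transc.wordClass_torsion _ 1 rfl)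

/-- **Entry**: every representation pinned as `β(1/3,1/3)` (domain `(0,1)`, integrand
`t^{-2/3}(1−t)^{-2/3}` on it) has the class `betaClass (1/3) (1/3)`. [folklore] -/
theorem toFormalPeriod_of_isBetaRep_third (s : KZ.IntegralRep 1) (hs : IsBetaRep (1 / 3) (1 / 3) s) :
    KZ.toFormalPeriod (KZ.of s) = betaClass (1 / 3) (1 / 3) :=
  hs.toFormalPeriod_eq (by norm_num) (by norm_num)

/-- **Equal values ⇒ KZ-equivalent on the `ℚ̄[B(1/3,1/3), π]`-root ring** (two-representation form).
[cite: KontsevichZagier2001, §1.2] -/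
theorem equivalent_of_mem_betaThirdPiSector {n m : ℕ} (r : KZ.IntegralRep n) (r' : KZ.IntegralRep m)
    (hr : KZ.toFormalPeriod (KZ.of r) ∈ Subring.closure
        (Set.range (fun b : KZ.IntegralRep 0 => KZ.toFormalPeriod (KZ.of b)) ∪
          Set.range (![betaClass (1 / 3) (1 / 3), KZ.toFormalPeriod (KZ.of KZ.piRep)] :
            Fin 2 → KZ.FormalPeriodRing) ∪
          KZ.toFormalPeriod '' (genSetAdm 2 ∪ genSetAdm 4)))
    (hr' : KZ.toFormalPeriod (KZ.of r') ∈ Subring.closure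
        (Set.range (fun b : KZ.IntegralRep 0 => KZ.toFormalPeriod (KZ.of b)) ∪
          Set.range (![betaClass (1 / 3) (1 / 3), KZ.toFormalPeriod (KZ.of KZ.piRep)] :
            Fin 2 → KZ.FormalPeriodRing) ∪
          KZ.toFormalPeriod '' (genSetAdm 2 ∪ genSetAdm 4)))
    (hv : r.value = r'.value) : KZ.Equivalent r r' :=
  transc_sub_mem_relations _ Transc.algebraicIndependent_vecB3Pi _ (Transc.wordClass_torsion _ 1 rfl)
    (KZ.of r) (KZ.of r') hr hr' (by rw [KZ.eval_of, KZ.eval_of, hv])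

/-! ### The lemniscatic Beta value `B(1/4,1/4)` -/

namespace Transc

/-- The values of the family `![β(1/4,1/4), ⟦piRep⟧]`. [folklore] -/
theorem evalP_vecB4Pi :
    (fun i : Fin 2 => KZ.evalP ((![betaClass (1 / 4) (1 / 4), KZ.toFormalPeriod (KZ.of KZ.piRep)] :
      Fin 2 → KZ.FormalPeriodRing) i)) =
      ![ProbabilityTheory.beta ((1 / 4 : ℚ) : ℝ) ((1 / 4 : ℚ) : ℝ), Real.pi] := by
  funext i
  fin_cases i
  · simp only [Fin.zero_eta, Fin.isValue, Matrix.cons_val_zero]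
    exact evalP_betaClass (1 / 4) (1 / 4) (by norm_num) (by norm_num)
  · simp [KZ.piRep_value]

/-- **Chudnovsky (lemniscatic) in `P`**: the values of `β(1/4,1/4)`, `⟦piRep⟧` are algebraically
independent (`tateLifting_betaQuarterPiAlgIndependent`, stub 36). [cite: Chudnovsky1984, Ch. 7 §2 Corollary 2.3] -/
theorem algebraicIndependent_vecB4Pi :
    AlgebraicIndependent ℚ fun i : Fin 2 =>
      KZ.evalP ((![betaClass (1 / 4) (1 / 4), KZ.toFormalPeriod (KZ.of KZ.piRep)] :
        Fin 2 → KZ.FormalPeriodRing) i) := by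
  rw [evalP_vecB4Pi]
  exact tateLifting_betaQuarterPiAlgIndependent

end Transc

/-- **THE `ℚ̄[B(1/4,1/4), π]`-ROOT RING THROUGH WEIGHT 4 — UNCONDITIONAL.** `evalP` is injective on the
subring generated by all dimension-zero classes, the Beta class `β(1/4,1/4) = ⟦[(0,1), t^{-3/4}(1−t)^{-3/4}]⟧`
(value `Γ(1/4)²/√π = 4·K(1/√2)`), the disc `⟦piRep⟧` and the admissible word classes of weights `2`, `4`.
[cite: Chudnovsky1984, Ch. 7 §2 Corollary 2.3] -/
theorem betaQuarterPiSectorRingKernel :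
    ∀ y ∈ Subring.closure
        (Set.range (fun b : KZ.IntegralRep 0 => KZ.toFormalPeriod (KZ.of b)) ∪
          Set.range (![betaClass (1 / 4) (1 / 4), KZ.toFormalPeriod (KZ.of KZ.piRep)] :
            Fin 2 → KZ.FormalPeriodRing) ∪
          KZ.toFormalPeriod '' (genSetAdm 2 ∪ genSetAdm 4)),
      KZ.evalP y = 0 → y = 0 :=
  transcRingKernel_sat _ Transc.algebraicIndependent_vecB4Pi _ (Transc.wordClass_torsion _ 1 rfl)

/-- **Entry**: every representation pinned as `β(1/4,1/4)` has the class `betaClass (1/4) (1/4)`. [folklore] -/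
theorem toFormalPeriod_of_isBetaRep_quarter (s : KZ.IntegralRep 1) (hs : IsBetaRep (1 / 4) (1 / 4) s) :
    KZ.toFormalPeriod (KZ.of s) = betaClass (1 / 4) (1 / 4) :=
  hs.toFormalPeriod_eq (by norm_num) (by norm_num)

/-- **Equal values ⇒ KZ-equivalent on the `ℚ̄[B(1/4,1/4), π]`-root ring** (two-representation form).
[cite: KontsevichZagier2001, §1.2] -/
theorem equivalent_of_mem_betaQuarterPiSector {n m : ℕ} (r : KZ.IntegralRep n) (r' : KZ.IntegralRep m)
    (hr : KZ.toFormalPeriod (KZ.of r) ∈ Subring.closure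
        (Set.range (fun b : KZ.IntegralRep 0 => KZ.toFormalPeriod (KZ.of b)) ∪
          Set.range (![betaClass (1 / 4) (1 / 4), KZ.toFormalPeriod (KZ.of KZ.piRep)] :
            Fin 2 → KZ.FormalPeriodRing) ∪
          KZ.toFormalPeriod '' (genSetAdm 2 ∪ genSetAdm 4)))
    (hr' : KZ.toFormalPeriod (KZ.of r') ∈ Subring.closure
        (Set.range (fun b : KZ.IntegralRep 0 => KZ.toFormalPeriod (KZ.of b)) ∪
          Set.range (![betaClass (1 / 4) (1 / 4), KZ.toFormalPeriod (KZ.of KZ.piRep)] :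
            Fin 2 → KZ.FormalPeriodRing) ∪
          KZ.toFormalPeriod '' (genSetAdm 2 ∪ genSetAdm 4)))
    (hv : r.value = r'.value) : KZ.Equivalent r r' :=
  transc_sub_mem_relations _ Transc.algebraicIndependent_vecB4Pi _ (Transc.wordClass_torsion _ 1 rfl)
    (KZ.of r) (KZ.of r') hr hr' (by rw [KZ.eval_of, KZ.eval_of, hv])

end Summit.KontsevichZagierPeriods.InverseLandau

end
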